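import Summits.BirchSwinnertonDyer.BirchSwinnertonDyer.Theorems.SignedLowerHalvesSmallImageLowerHalfBothSignsRttD2TwistLevelCores
import Summits.BirchSwinnertonDyer.BirchSwinnertonDyer.Theorems.SignedLowerHalvesSmallImageLowerHalfBothSignsRttD2TwistLevelNaturality
import Summits.BirchSwinnertonDyer.BirchSwinnertonDyer.Theorems.SignedLowerHalvesSmallImageLowerHalfBothSignsRttD2TwistLevelConj
import HarnessLib

/-!
# Route `SignedLowerHalves`, crux L `SmallImageLowerHalfBothSigns` (stmt-BirchSwinnertonDyer-23599), line `rtt_w3` v14 — E2, row «D-tw-coh» part 2c(i):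
# the twist on the `ℤ_p²`-TOWER — iterated corestrictions, the layer twists, and the twisted compatible family

INPUTS hand `bsd-inputs-honda-p1` g23 (LEAD g11 RULING «U» (U5)). Setting of `IwasawaCohomologyDataO`: the layer groups
`H^i(G_S(K̃_n), 𝒪 ⊗ μ_{p^k} ⊗ θ)` (`layerCohO`, `S = supp(p𝔣)`), two characters `θ, θ'` with `θ' ≡ θ (mod p^k)` on `N_S` (all `k`) and on
`Gal(K̄/K̃_{m(k)})` for a MONOTONE threshold `m : ℕ → ℕ` (continuity of `η = θ'/θ` on `Gal(K̃_∞/K) ≅ ℤ_p²`).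
* §1 `layerCoresLEO h` (`n ≤ M`): the ITERATED corestriction `H^i(K̃_M) → H^i(K̃_n)` as the composite of the one-step `layerCoresO`
  (`Nat.leRec`; no transitivity of `cor` is used): `_refl`, `_succ`, ★ `layerCoresO_layerCoresLEO` (peeling at the bottom), ★ `layerRedO_layerCoresLEO`,
  ★ `proj_eq_layerCoresLEO` ((P1) iterated) and ★ `eq_zero_of_proj_eq_zero_of_le` (COFINAL injectivity).
* §2 `layerTwistO m hN hm n k i hn` (`m k ≤ n`): the level twist of part 1a on the layer `K̃_n`; its compatibilities with `layerCoresO` (part 2a),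
  `layerRedO` and `layerScalarO` (part 1b) and its conj-semilinearity (part 2b), read on layers.
* §3 ★★ `layerCoresLEO_layerTwistO_eq` — `cor_{K̃_M/K̃_n} (tw_M y_M)` does not depend on the auxiliary level `M ≥ n, m(k)` for a cores-compatible
  family `y`; §4 ★★★ `isCompatibleFamilyO_twistFamily` — the TWISTED family `z_{n,k} := cor_{K̃_M/K̃_n}(tw_M y_{M,k})`, `M = max n m(k)`, of a
  compatible family `y` is compatible (for `θ'`), and `twistFamily_eq_layerTwistO` — `z_{n,k} = tw_n y_{n,k}` whenever `m k ≤ n`.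
Sequel (part 2c(ii), `…RttD2TwistAssembly`): the additive map `Tw : D(θ).H → D(θ').H` through (P3)/(P4) and its semilinearity.
DEFS (`layerCoresLEO`, `layerTwistO`, `twistFamily`) + THEOREMS; no named fact, no `sorry`; crux L, crux M, E2 and BSD remain OPEN and are
proved for NO curve by any of this.
References: [JohnsonLeungKings2011] §4.1–§4.2, Def. 4.2 (94); [Rubin2000] Ch. VI §6.1–6.2; [Kato2004Asterisque] §8.2; [NeukirchSchmidtWingberg2008] I §5.
-/

set_option autoImplicit false
-- the Theorems namespace of this sub repeats the summit name by design (D-0017 nested layout)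
set_option linter.dupNamespace false

noncomputable section

open scoped NumberField TensorProduct
open CategoryTheory Field IsDedekindDomain
open Literature.NumberTheory.GaloisRepresentations
open Literature.NumberTheory.GaloisRepresentations.DiscreteGaloisModule
open Literature.NumberTheory.EllipticCurves
open Literature.NumberTheory.ComplexMultiplication.EllipticUnits
open Literature.NumberTheory.ComplexMultiplication.EllipticUnits.JohnsonLeungKings2011

namespace Summit.BirchSwinnertonDyer.BirchSwinnertonDyer.Theorems.SmallImageRttD2Twist

variable {K : Type} [Field K] [NumberField K] {p : ℕ} [Fact p.Prime] (S : Set (PadicAlgCl p))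
  (κ₁ κ₂ : ZpExtension K p) (θ θ' : absoluteGaloisGroup K →ₜ* (padicCoeffIntegers S)ˣ) (𝔣 : Ideal (𝓞 K))

/-! ## §1 Iterated corestrictions on the tower -/

/-- **The iterated corestriction `cor_{K̃_M/K̃_n} : H^i(G_S(K̃_M), ·) → H^i(G_S(K̃_n), ·)`** for `n ≤ M`, as the COMPOSITE of the one-step
transition maps `layerCoresO` (recursion on the proof of `n ≤ M`; no transitivity of `cor` is asserted).
[cite: JohnsonLeungKings2011, Def. 4.2 (94) (arXiv p0012:L94)] [cite: NeukirchSchmidtWingberg2008, I §5 Prop. 1.5.3] -/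
def layerCoresLEO (k i : ℕ) {n M : ℕ} (h : n ≤ M) : layerCohO S κ₁ κ₂ θ 𝔣 M k i →+ layerCohO S κ₁ κ₂ θ 𝔣 n k i :=
  Nat.leRec (motive := fun M _ ↦ layerCohO S κ₁ κ₂ θ 𝔣 M k i →+ layerCohO S κ₁ κ₂ θ 𝔣 n k i)
    (AddMonoidHom.id _) (fun M _ f ↦ f.comp (layerCoresO S κ₁ κ₂ θ 𝔣 M k i)) h

/-- `cor_{K̃_n/K̃_n} = id`. [cite: NeukirchSchmidtWingberg2008, I §5 Prop. 1.5.3] -/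
theorem layerCoresLEO_refl (k i n : ℕ) (y : layerCohO S κ₁ κ₂ θ 𝔣 n k i) :
    layerCoresLEO S κ₁ κ₂ θ 𝔣 k i (le_refl n) y = y := by
  rw [layerCoresLEO, Nat.leRec_self]; rfl

/-- Peeling at the top: `cor_{K̃_{M+1}/K̃_n} = cor_{K̃_M/K̃_n} ∘ cor_{K̃_{M+1}/K̃_M}`. [cite: NeukirchSchmidtWingberg2008, I §5 Prop. 1.5.3] -/
theorem layerCoresLEO_succ (k i : ℕ) {n M : ℕ} (h : n ≤ M) (h' : n ≤ M + 1) (y : layerCohO S κ₁ κ₂ θ 𝔣 (M + 1) k i) :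
    layerCoresLEO S κ₁ κ₂ θ 𝔣 k i h' y = layerCoresLEO S κ₁ κ₂ θ 𝔣 k i h (layerCoresO S κ₁ κ₂ θ 𝔣 M k i y) := by
  rw [layerCoresLEO, Nat.leRec_succ _ _ h]; rfl

/-- ★ Peeling at the bottom: `cor_{K̃_{n+1}/K̃_n} ∘ cor_{K̃_M/K̃_{n+1}} = cor_{K̃_M/K̃_n}`. [cite: NeukirchSchmidtWingberg2008, I §5 Prop. 1.5.3] -/
theorem layerCoresO_layerCoresLEO (k i n : ℕ) :
    ∀ (M : ℕ) (h : n + 1 ≤ M) (h' : n ≤ M) (y : layerCohO S κ₁ κ₂ θ 𝔣 M k i),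
      layerCoresO S κ₁ κ₂ θ 𝔣 n k i (layerCoresLEO S κ₁ κ₂ θ 𝔣 k i h y) = layerCoresLEO S κ₁ κ₂ θ 𝔣 k i h' y := by
  refine Nat.le_induction (fun h' y ↦ ?_) (fun M hM ih h' y ↦ ?_)
  · rw [layerCoresLEO_refl, layerCoresLEO_succ S κ₁ κ₂ θ 𝔣 k i (le_refl n) h', layerCoresLEO_refl]
  · rw [layerCoresLEO_succ S κ₁ κ₂ θ 𝔣 k i hM (Nat.le_succ_of_le hM), ih (Nat.le_of_succ_le hM),
      layerCoresLEO_succ S κ₁ κ₂ θ 𝔣 k i (Nat.le_of_succ_le hM) h']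

/-- ★ The iterated corestrictions commute with the reduction of coefficients. [cite: Kato2004Asterisque, §8.2 (p. 180)] [cite: NeukirchSchmidtWingberg2008, I §5 Prop. 1.5.2] -/
theorem layerRedO_layerCoresLEO (k i n : ℕ) :
    ∀ (M : ℕ) (h : n ≤ M) (y : layerCohO S κ₁ κ₂ θ 𝔣 M (k + 1) i),
      layerRedO S κ₁ κ₂ θ 𝔣 n k i (layerCoresLEO S κ₁ κ₂ θ 𝔣 (k + 1) i h y) =
        layerCoresLEO S κ₁ κ₂ θ 𝔣 k i h (layerRedO S κ₁ κ₂ θ 𝔣 M k i y) := by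
  refine Nat.le_induction (fun y ↦ ?_) (fun M hM ih y ↦ ?_)
  · rw [layerCoresLEO_refl, layerCoresLEO_refl]
  · rw [layerCoresLEO_succ S κ₁ κ₂ θ 𝔣 (k + 1) i hM, ih, ← layerCoresO_layerRedO,
      layerCoresLEO_succ S κ₁ κ₂ θ 𝔣 k i hM]

variable {S κ₁ κ₂ θ 𝔣} in
/-- ★ **(P1) iterated**: `proj_{n,k} = cor_{K̃_M/K̃_n} ∘ proj_{M,k}` for `n ≤ M`. [cite: JohnsonLeungKings2011, Def. 4.2 (94) (arXiv p0012:L94)] -/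
theorem proj_eq_layerCoresLEO {γ₁ γ₂ : absoluteGaloisGroup K} {i : ℕ} (D : IwasawaCohomologyDataO S κ₁ κ₂ γ₁ γ₂ θ 𝔣 i) (k n : ℕ) :
    ∀ (M : ℕ) (h : n ≤ M) (x : D.H), D.proj n k x = layerCoresLEO S κ₁ κ₂ θ 𝔣 k i h (D.proj M k x) := by
  refine Nat.le_induction (fun x ↦ ?_) (fun M hM ih x ↦ ?_)
  · rw [layerCoresLEO_refl]
  · rw [layerCoresLEO_succ S κ₁ κ₂ θ 𝔣 k i hM, D.proj_cores, ← ih]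

variable {S κ₁ κ₂ θ 𝔣} in
/-- ★ **COFINAL injectivity**: an element of `H^i(𝒪_K[1/p𝔣], Λ_𝒪(χ)(1))` whose level components vanish for `n ≥ m(k)` (any thresholds `m`) is zero
((P3) with (P1) iterated). [cite: JohnsonLeungKings2011, Def. 4.2 (94) (arXiv p0012:L94)] -/
theorem eq_zero_of_proj_eq_zero_of_le {γ₁ γ₂ : absoluteGaloisGroup K} {i : ℕ} (D : IwasawaCohomologyDataO S κ₁ κ₂ γ₁ γ₂ θ 𝔣 i) (m : ℕ → ℕ) (x : D.H)
    (hx : ∀ k n, m k ≤ n → D.proj n k x = 0) : x = 0 :=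
  D.proj_injective x fun n k ↦ by
    rw [proj_eq_layerCoresLEO D k n (max n (m k)) (le_max_left _ _), hx k _ (le_max_right _ _), map_zero]

/-! ## §2 The layer twists -/

section Twist

variable (m : ℕ → ℕ)
  (hN : ∀ k, ∀ σ ∈ ramificationSubgroup K (suppPF p 𝔣), ∃ b : padicCoeffIntegers S,
    ((θ' σ : (padicCoeffIntegers S)ˣ) : padicCoeffIntegers S) = (θ σ : (padicCoeffIntegers S)ˣ) + ((p : padicCoeffIntegers S)) ^ k * b)
  (hm : ∀ k, ∀ σ ∈ JohnsonLeungKings2011.pairLayerSubgroup κ₁ κ₂ (m k), ∃ b : padicCoeffIntegers S,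
    ((θ' σ : (padicCoeffIntegers S)ˣ) : padicCoeffIntegers S) = (θ σ : (padicCoeffIntegers S)ˣ) + ((p : padicCoeffIntegers S)) ^ k * b)

include hm

omit [NumberField K] in
/-- The congruence `θ' ≡ θ (mod p^k)` holds on `Gal(K̄/K̃_n)` for every `n ≥ m(k)` (the layer subgroups decrease). [cite: JohnsonLeungKings2011, §4.1 (arXiv p0012:L12–14)] -/
theorem congr_layer {k n : ℕ} (hn : m k ≤ n) :
    ∀ σ ∈ JohnsonLeungKings2011.pairLayerSubgroup κ₁ κ₂ n, ∃ b : padicCoeffIntegers S,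
      ((θ' σ : (padicCoeffIntegers S)ˣ) : padicCoeffIntegers S) = (θ σ : (padicCoeffIntegers S)ˣ) + ((p : padicCoeffIntegers S)) ^ k * b :=
  fun σ hσ ↦ hm k σ (pairLayerSubgroup_antitone κ₁ κ₂ hn hσ)

include hN

/-- **The layer twist `tw_n : H^i(G_S(K̃_n), 𝒪 ⊗ μ_{p^k} ⊗ θ) → H^i(G_S(K̃_n), 𝒪 ⊗ μ_{p^k} ⊗ θ')`** for `n ≥ m(k)` (part 1a's `levelTwistO` on the layer
`U = Gal(K̄/K̃_n)`; identity on cochains). [cite: Rubin2000, Ch. VI §6.1–6.2] [cite: SerreGaloisCohomology1997, I §2.2] -/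
def layerTwistO (n k i : ℕ) (hn : m k ≤ n) : layerCohO S κ₁ κ₂ θ 𝔣 n k i →+ layerCohO S κ₁ κ₂ θ' 𝔣 n k i :=
  levelTwistO S (suppPF p 𝔣) θ θ' k (hN k) (JohnsonLeungKings2011.pairLayerSubgroup κ₁ κ₂ n) (congr_layer S κ₁ κ₂ θ θ' m hm hn) i

/-- The layer twist commutes with the one-step corestriction (part 2a on layers). [cite: NeukirchSchmidtWingberg2008, I §5 Prop. 1.5.2] [cite: Rubin2000, Ch. VI §6.1–6.2] -/
theorem layerCoresO_layerTwistO (i : ℕ) {n k : ℕ} (hn : m k ≤ n) (y : layerCohO S κ₁ κ₂ θ 𝔣 (n + 1) k i) :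
    layerCoresO S κ₁ κ₂ θ' 𝔣 n k i (layerTwistO S κ₁ κ₂ θ θ' 𝔣 m hN hm (n + 1) k i (Nat.le_succ_of_le hn) y) =
      layerTwistO S κ₁ κ₂ θ θ' 𝔣 m hN hm n k i hn (layerCoresO S κ₁ κ₂ θ 𝔣 n k i y) :=
  relCoresO_levelTwistO S (suppPF p 𝔣) θ θ' k (hN k) (pairLayerSubgroup_antitone κ₁ κ₂ (Nat.le_succ n))
    (isOpen_pairLayerSubgroup κ₁ κ₂ n) (isOpen_pairLayerSubgroup κ₁ κ₂ (n + 1)) (congr_layer S κ₁ κ₂ θ θ' m hm hn) i y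

omit [NumberField K] in
/-- The layer twists commute with the reduction of coefficients (part 1b on layers; `m` monotone). [cite: Kato2004Asterisque, §8.2 (p. 180)] [cite: SerreGaloisCohomology1997, I §2.2] -/
theorem layerRedO_layerTwistO (hmono : Monotone m) (i : ℕ) {n k : ℕ} (hn : m (k + 1) ≤ n) (y : layerCohO S κ₁ κ₂ θ 𝔣 n (k + 1) i) :
    layerRedO S κ₁ κ₂ θ' 𝔣 n k i (layerTwistO S κ₁ κ₂ θ θ' 𝔣 m hN hm n (k + 1) i hn y) =
      layerTwistO S κ₁ κ₂ θ θ' 𝔣 m hN hm n k i ((hmono (Nat.le_succ k)).trans hn) (layerRedO S κ₁ κ₂ θ 𝔣 n k i y) :=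
  (levelTwistO_levelRedO S (suppPF p 𝔣) θ θ' k (hN k) (JohnsonLeungKings2011.pairLayerSubgroup κ₁ κ₂ n)
    (congr_layer S κ₁ κ₂ θ θ' m hm ((hmono (Nat.le_succ k)).trans hn)) (hN (k + 1)) (congr_layer S κ₁ κ₂ θ θ' m hm hn) i y).symm

omit [NumberField K] in
/-- The layer twists are `𝒪`-linear (part 1b on layers). [cite: JohnsonLeungKings2011, §4.1 Def. 4.1 (arXiv p0012:L59–60)] [cite: SerreGaloisCohomology1997, I §2.2] -/
theorem layerTwistO_layerScalarO (i : ℕ) {n k : ℕ} (hn : m k ≤ n) (c : padicCoeffIntegers S) (y : layerCohO S κ₁ κ₂ θ 𝔣 n k i) :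
    layerTwistO S κ₁ κ₂ θ θ' 𝔣 m hN hm n k i hn (layerScalarO S κ₁ κ₂ θ 𝔣 n k i c y) =
      layerScalarO S κ₁ κ₂ θ' 𝔣 n k i c (layerTwistO S κ₁ κ₂ θ θ' 𝔣 m hN hm n k i hn y) :=
  levelTwistO_levelScalarO S (suppPF p 𝔣) θ θ' k (hN k) (JohnsonLeungKings2011.pairLayerSubgroup κ₁ κ₂ n) (congr_layer S κ₁ κ₂ θ θ' m hm hn) i c y

omit [NumberField K] in
/-- The layer twists are conj-SEMILINEAR (part 2b on layers): `tw (γ · y) = (θ(γ)θ'(γ)⁻¹) · (γ · tw y)`.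
[cite: Rubin2000, Ch. VI §6.1–6.2] [cite: NeukirchSchmidtWingberg2008, I §5 Prop. 1.5.4] -/
theorem layerTwistO_layerConjO (i : ℕ) {n k : ℕ} (hn : m k ≤ n) (γ : absoluteGaloisGroup K) (y : layerCohO S κ₁ κ₂ θ 𝔣 n k i) :
    layerTwistO S κ₁ κ₂ θ θ' 𝔣 m hN hm n k i hn (layerConjO S κ₁ κ₂ θ 𝔣 n k i γ y) =
      layerScalarO S κ₁ κ₂ θ' 𝔣 n k i (((θ γ * (θ' γ)⁻¹ : (padicCoeffIntegers S)ˣ)) : padicCoeffIntegers S)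
        (layerConjO S κ₁ κ₂ θ' 𝔣 n k i γ (layerTwistO S κ₁ κ₂ θ θ' 𝔣 m hN hm n k i hn y)) :=
  levelTwistO_levelConjO S (suppPF p 𝔣) θ θ' k (hN k) (JohnsonLeungKings2011.pairLayerSubgroup κ₁ κ₂ n) (congr_layer S κ₁ κ₂ θ θ' m hm hn) γ i y

/-! ## §3 `cor_{K̃_M/K̃_n} (tw_M y_M)` does not depend on the auxiliary level `M` -/

/-- ★★ For a cores-compatible family `y` and `M ≥ n, m(k)`, **`cor_{K̃_M/K̃_n}(tw_M y_{M,k})` is independent of `M`** (compared with the least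
admissible level `max n m(k)`): one step up is `cor ∘ cor_{M+1/M} ∘ tw_{M+1} = cor ∘ tw_M ∘ cor_{M+1/M}` (part 2a) and `cor_{M+1/M} y_{M+1} = y_M`.
[cite: Rubin2000, Ch. VI §6.1–6.2] [cite: JohnsonLeungKings2011, Def. 4.2 (94) (arXiv p0012:L94)] -/
theorem layerCoresLEO_layerTwistO_eq (i k n : ℕ) (y : ∀ n k : ℕ, layerCohO S κ₁ κ₂ θ 𝔣 n k i)
    (hyc : ∀ n k, layerCoresO S κ₁ κ₂ θ 𝔣 n k i (y (n + 1) k) = y n k) :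
    ∀ (M : ℕ) (hnM : n ≤ M) (hM : m k ≤ M),
      layerCoresLEO S κ₁ κ₂ θ' 𝔣 k i hnM (layerTwistO S κ₁ κ₂ θ θ' 𝔣 m hN hm M k i hM (y M k)) =
        layerCoresLEO S κ₁ κ₂ θ' 𝔣 k i (le_max_left n (m k))
          (layerTwistO S κ₁ κ₂ θ θ' 𝔣 m hN hm (max n (m k)) k i (le_max_right n (m k)) (y (max n (m k)) k)) := by
  intro M hnM hM
  have key : ∀ (M : ℕ) (hM₀ : max n (m k) ≤ M) (hnM : n ≤ M) (hM : m k ≤ M),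
      layerCoresLEO S κ₁ κ₂ θ' 𝔣 k i hnM (layerTwistO S κ₁ κ₂ θ θ' 𝔣 m hN hm M k i hM (y M k)) =
        layerCoresLEO S κ₁ κ₂ θ' 𝔣 k i (le_max_left n (m k))
          (layerTwistO S κ₁ κ₂ θ θ' 𝔣 m hN hm (max n (m k)) k i (le_max_right n (m k)) (y (max n (m k)) k)) := by
    refine Nat.le_induction (fun _ _ ↦ rfl) (fun M hM₀ ih hnM' hM' ↦ ?_)
    rw [layerCoresLEO_succ S κ₁ κ₂ θ' 𝔣 k i ((le_max_left n (m k)).trans hM₀) hnM',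
      layerCoresO_layerTwistO S κ₁ κ₂ θ θ' 𝔣 m hN hm i ((le_max_right n (m k)).trans hM₀), hyc,
      ih ((le_max_left n (m k)).trans hM₀) ((le_max_right n (m k)).trans hM₀)]
  exact key M (max_le hnM hM) hnM hM

/-! ## §4 The twisted family of a compatible family is compatible -/

/-- **The twisted family** `z_{n,k} := cor_{K̃_M/K̃_n}(tw_M y_{M,k})` with `M = max n m(k)` (by §3 any admissible `M` gives the same class).
[cite: Rubin2000, Ch. VI §6.1–6.2] [cite: JohnsonLeungKings2011, Def. 4.2 (94) (arXiv p0012:L94)] -/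
def twistFamily (i : ℕ) (y : ∀ n k : ℕ, layerCohO S κ₁ κ₂ θ 𝔣 n k i) (n k : ℕ) : layerCohO S κ₁ κ₂ θ' 𝔣 n k i :=
  layerCoresLEO S κ₁ κ₂ θ' 𝔣 k i (le_max_left n (m k))
    (layerTwistO S κ₁ κ₂ θ θ' 𝔣 m hN hm (max n (m k)) k i (le_max_right n (m k)) (y (max n (m k)) k))

/-- On the cofinal range `n ≥ m(k)` the twisted family is just the layer twist: `z_{n,k} = tw_n y_{n,k}`.
[cite: Rubin2000, Ch. VI §6.1–6.2] -/
theorem twistFamily_eq_layerTwistO (i : ℕ) (y : ∀ n k : ℕ, layerCohO S κ₁ κ₂ θ 𝔣 n k i)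
    (hyc : ∀ n k, layerCoresO S κ₁ κ₂ θ 𝔣 n k i (y (n + 1) k) = y n k) {n k : ℕ} (hn : m k ≤ n) :
    twistFamily S κ₁ κ₂ θ θ' 𝔣 m hN hm i y n k = layerTwistO S κ₁ κ₂ θ θ' 𝔣 m hN hm n k i hn (y n k) := by
  rw [twistFamily, ← layerCoresLEO_layerTwistO_eq S κ₁ κ₂ θ θ' 𝔣 m hN hm i k n y hyc n (le_refl n) hn, layerCoresLEO_refl]

/-- The twisted family read at any admissible auxiliary level. [cite: Rubin2000, Ch. VI §6.1–6.2] -/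
theorem twistFamily_eq (i : ℕ) (y : ∀ n k : ℕ, layerCohO S κ₁ κ₂ θ 𝔣 n k i)
    (hyc : ∀ n k, layerCoresO S κ₁ κ₂ θ 𝔣 n k i (y (n + 1) k) = y n k) {n k M : ℕ} (hnM : n ≤ M) (hM : m k ≤ M) :
    twistFamily S κ₁ κ₂ θ θ' 𝔣 m hN hm i y n k =
      layerCoresLEO S κ₁ κ₂ θ' 𝔣 k i hnM (layerTwistO S κ₁ κ₂ θ θ' 𝔣 m hN hm M k i hM (y M k)) := by
  rw [twistFamily, layerCoresLEO_layerTwistO_eq S κ₁ κ₂ θ θ' 𝔣 m hN hm i k n y hyc M hnM hM]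

/-- ★★★ **The twisted family of a compatible family is compatible** (cores: peel at the bottom and §3; reductions: `red ∘ cor = cor ∘ red`,
`red ∘ tw_{k+1} = tw_k ∘ red` and §3 again — `m` monotone). [cite: Rubin2000, Ch. VI §6.1–6.2] [cite: JohnsonLeungKings2011, Def. 4.2 (94) (arXiv p0012:L94)] [cite: Kato2004Asterisque, §8.2 (p. 180)] -/
theorem isCompatibleFamilyO_twistFamily (hmono : Monotone m) (i : ℕ) (y : ∀ n k : ℕ, layerCohO S κ₁ κ₂ θ 𝔣 n k i)
    (hy : IsCompatibleFamilyO S κ₁ κ₂ θ 𝔣 i y) :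
    IsCompatibleFamilyO S κ₁ κ₂ θ' 𝔣 i (twistFamily S κ₁ κ₂ θ θ' 𝔣 m hN hm i y) := by
  refine ⟨fun n k ↦ ?_, fun n k ↦ ?_⟩
  · rw [twistFamily, layerCoresO_layerCoresLEO S κ₁ κ₂ θ' 𝔣 k i n (max (n + 1) (m k)) (le_max_left _ _)
        ((Nat.le_succ n).trans (le_max_left _ _)),
      ← twistFamily_eq S κ₁ κ₂ θ θ' 𝔣 m hN hm i y hy.1]
  · rw [twistFamily, layerRedO_layerCoresLEO, layerRedO_layerTwistO S κ₁ κ₂ θ θ' 𝔣 m hN hm hmono, hy.2,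
      ← twistFamily_eq S κ₁ κ₂ θ θ' 𝔣 m hN hm i y hy.1]

end Twist

end Summit.BirchSwinnertonDyer.BirchSwinnertonDyer.Theorems.SmallImageRttD2Twist

end
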